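import Summits.QuantumAdvantage.QuantumAdvantage.Theorems.LinnikCubicClassGroupsPureCubicClassGroupFBQPStubAdmissibleFields
import Summits.QuantumAdvantage.QuantumAdvantage.Theorems.LinnikCubicClassGroupsDegreeOnePrimesEscapeResidueUpper
import Literature.NumberTheory.CubicFields.ArtinUnitInequality
import HarnessLib

/-!
# An explicit regulator lower bound and class number upper bound for cubic fields with one real place

Topic `Summits/QuantumAdvantage/QuantumAdvantage/Theorems`, helper file of the (closed) crux
`DegreeOnePrimesEscape` (stmt-QuantumAdvantage-11543) of route `LinnikCubicClassGroups`; cell B2b-1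
(linnik-cubic), PART B — the family of the booked FBQP theorem is the pure cubic fields `ℚ(∛m)`, which
have exactly one real place.  HONEST FRAMING: value = THEOREM (explicit, kernel-checked combination of
Artin's inequality and Landau's bound), NOT summit progress.

* `regulator_ge_of_real_complex` — for a cubic field `K` with a real embedding `σ₁` and a non-real
  embedding `σ₂`: `R_K ≥ (log|d_K| − log 28)/3` (Artin's inequality
  `Literature…ArtinUnitInequality.log_abs_discr_le_of_unit` at the fundamental unit `ε > 1` with
  `log σ₁ ε = R_K`, tree `LinnikCubicClassGroups.stub_regulatorPeriod`).
* `classNumber_le_of_real_complex` — for the same fields with `|d_K| > 28`: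
  `h_K ≤ 21 · √|d_K| · log²|d_K| / (log|d_K| − log 28)` (with Landau's bound
  `Residue.classNumber_mul_regulator_le_cubic`: `h_K R_K ≤ 7√|d_K| log²|d_K|`).
* `regulator_ge_pureCubic`, `classNumber_le_pureCubic` — the same for every PURE cubic field `K ∋ ∛m`
  (`m` not a cube; embeddings from the tree's `LinnikCubicClassGroups.admissible_structure`); with
  `|d_K| ≤ 27m²` (`stub_cubicFieldFacts`) this is `h(ℚ(∛m)) = O(m log m)` with explicit constants.

## References
* Ş. Alaca, K. S. Williams, *Introductory Algebraic Number Theory* (2004), Thm 13.6.1. [AlacaWilliams2003]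
* S. Louboutin, J. Number Theory 85 (2000) 263–282. [Louboutin2000]
-/

noncomputable section

open NumberField NumberField.InfinitePlace NumberField.Units

namespace Summit.QuantumAdvantage.QuantumAdvantage.Theorems.DegreeOnePrimesEscape

namespace Residue

open Literature.NumberTheory.CubicFields

/-- **`R_K ≥ (log|d_K| − log 28)/3`** for every cubic field `K` with a real embedding `σ₁` and a non-real
embedding `σ₂` (Artin's inequality at the fundamental unit). [cite: AlacaWilliams2003, Thm 13.6.1] -/
theorem regulator_ge_of_real_complex (K : Type) [Field K] [NumberField K] (hdeg : Module.finrank ℚ K = 3)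
    (σ₁ : K →+* ℝ) (σ₂ : K →+* ℂ) (hσ₂ : ∃ z : K, starRingEnd ℂ (σ₂ z) ≠ σ₂ z) :
    (Real.log |(discr K : ℝ)| - Real.log 28) / 3 ≤ regulator K := by
  obtain ⟨ε, hε1, hreg, -⟩ :=
    Summit.QuantumAdvantage.QuantumAdvantage.Theorems.LinnikCubicClassGroups.stub_regulatorPeriod K hdeg σ₁ σ₂ hσ₂
  have h := log_abs_discr_le_of_unit σ₁ σ₂ hdeg hσ₂ ε hε1
  rw [hreg] at h
  linarith

/-- **`h_K ≤ 21 · √|d_K| · log²|d_K| / (log|d_K| − log 28)`** for every cubic field with one real place and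
`|d_K| > 28` (Landau's upper bound `h_K R_K ≤ 7√|d_K| log²|d_K|` divided by Artin's regulator lower bound).
[cite: AlacaWilliams2003, Thm 13.6.1; Louboutin2000, Thm 1] -/
theorem classNumber_le_of_real_complex (K : Type) [Field K] [NumberField K] (hdeg : Module.finrank ℚ K = 3)
    (σ₁ : K →+* ℝ) (σ₂ : K →+* ℂ) (hσ₂ : ∃ z : K, starRingEnd ℂ (σ₂ z) ≠ σ₂ z)
    (hd : (28 : ℝ) < |(discr K : ℝ)|) :
    (classNumber K : ℝ) ≤
      21 * Real.sqrt |(discr K : ℝ)| * Real.log |(discr K : ℝ)| ^ 2 / (Real.log |(discr K : ℝ)| - Real.log 28) := by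
  have hR := regulator_ge_of_real_complex K hdeg σ₁ σ₂ hσ₂
  have hup := classNumber_mul_regulator_le_cubic K hdeg
  have hlog : Real.log 28 < Real.log |(discr K : ℝ)| := Real.log_lt_log (by norm_num) hd
  have hden : 0 < Real.log |(discr K : ℝ)| - Real.log 28 := by linarith
  have hR0 : 0 < regulator K := regulator_pos K
  have hh0 : (0 : ℝ) ≤ classNumber K := by positivity
  rw [le_div_iff₀ hden]
  -- `h · (log d − log 28) ≤ 3 h R ≤ 21 √d log² d`
  calc (classNumber K : ℝ) * (Real.log |(discr K : ℝ)| - Real.log 28)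
      = 3 * ((classNumber K : ℝ) * ((Real.log |(discr K : ℝ)| - Real.log 28) / 3)) := by ring
    _ ≤ 3 * ((classNumber K : ℝ) * regulator K) := by
        apply mul_le_mul_of_nonneg_left _ (by norm_num)
        exact mul_le_mul_of_nonneg_left hR hh0
    _ ≤ 3 * (7 * Real.sqrt |(discr K : ℝ)| * Real.log |(discr K : ℝ)| ^ 2) :=
        mul_le_mul_of_nonneg_left hup (by norm_num)
    _ = 21 * Real.sqrt |(discr K : ℝ)| * Real.log |(discr K : ℝ)| ^ 2 := by ring

/-- **`R_K ≥ (log|d_K| − log 28)/3` for every pure cubic field** `K ∋ ∛m` (`m` not a cube).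
[cite: AlacaWilliams2003, Thm 13.6.1] -/
theorem regulator_ge_pureCubic (K : Type) [Field K] [NumberField K] (hdeg : Module.finrank ℚ K = 3)
    {m : ℕ} (hm : ∀ r : ℕ, r ^ 3 ≠ m) {α : K} (hα : α ^ 3 = (m : K)) :
    (Real.log |(discr K : ℝ)| - Real.log 28) / 3 ≤ regulator K := by
  obtain ⟨-, -, σ₁, σ₂, hσ₂, -⟩ :=
    Summit.QuantumAdvantage.QuantumAdvantage.Theorems.LinnikCubicClassGroups.admissible_structure hdeg hm hα
  exact regulator_ge_of_real_complex K hdeg σ₁ σ₂ hσ₂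

/-- **`h_K ≤ 21 · √|d_K| · log²|d_K| / (log|d_K| − log 28)` for every pure cubic field** `K ∋ ∛m` with
`|d_K| > 28` (`m` not a cube). [cite: AlacaWilliams2003, Thm 13.6.1; Louboutin2000, Thm 1] -/
theorem classNumber_le_pureCubic (K : Type) [Field K] [NumberField K] (hdeg : Module.finrank ℚ K = 3)
    {m : ℕ} (hm : ∀ r : ℕ, r ^ 3 ≠ m) {α : K} (hα : α ^ 3 = (m : K)) (hd : (28 : ℝ) < |(discr K : ℝ)|) :
    (classNumber K : ℝ) ≤
      21 * Real.sqrt |(discr K : ℝ)| * Real.log |(discr K : ℝ)| ^ 2 / (Real.log |(discr K : ℝ)| - Real.log 28) := by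
  obtain ⟨-, -, σ₁, σ₂, hσ₂, -⟩ :=
    Summit.QuantumAdvantage.QuantumAdvantage.Theorems.LinnikCubicClassGroups.admissible_structure hdeg hm hα
  exact classNumber_le_of_real_complex K hdeg σ₁ σ₂ hσ₂ hd

end Residue

end Summit.QuantumAdvantage.QuantumAdvantage.Theorems.DegreeOnePrimesEscape

end
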